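import Literature.Geometry.Lorentzian.CorrespondingBoundaryShadow
import HarnessLib

/-!
# Corresponding boundary points over a sub-datum, II: the image point lies in the Cauchy piece
# domain of the sub-datum

Sequel to `CorrespondingBoundaryShadow` (same pure setting: `M₁ ⊇ U ⊇ S₁`, `M₂ ⊇ W`, Cauchy
hypersurfaces `S₁`, `S₂`, sub-datum `S₀` with `W ∩ S₂ ⊆ S₀ ⊆ S₂`, a map `ψ` continuous on `U`
transporting timelike segments, a corresponding pair `(p, p')`, Sbierski 2016, Def. 11). Put
`K = S₂ ∖ S₀` and `F = I⁺(K) ∪ I⁻(K) ∪ K` — the set whose closure is removed from `M₂` to form the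
Cauchy piece domain of `S₀` (`CauchyPieceDomain`, Hawking–Ellis 1973, §6.5). **Theorem
(`not_mem_closure_badSet_of_corresponding`): `p' ∉ closure F`.** So corresponding boundary
points of a relative common development `(U ⊆ M₁, ψ)` of a development of the data on `N` and a
development `M₂` of the data on `X ⊇ Φ(N)` have their image point inside the domain of dependence
of the sub-datum `ι₂(Φ N)` in `M₂` — the step by which the relative form of Sbierski's Theorem 12
(no corresponding boundary points for a maximal common development; Hawking–Ellis 1973, §7.6)
reduces to the printed same-data theorem applied inside that domain.

Proof of the future case (`p ∈ I⁺(S₁)`; `not_mem_closure_chronologicalFuture_diff_of_corresponding`),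
with the global-hyperbolicity consequences displayed as in `SpacelikeBoundaryFuturePoint`
(`hK₁`, `hK₂`: compactness of `J⁻(x) ∩ J⁺(S)`, Hawking–Ellis Prop. 6.6.6; `hrel₂`: sequential
closedness of `≤`, O'Neill Lemma 14.22) and the acausality of `S₂` (`hac₂`, O'Neill p. 425; for a
data hypersurface `IsCauchyHypersurface.false_of_isFutureCausalCurveOn_of_spacelike`). By part I,
`p' ∈ I⁺(S₂) ∖ S₂`, `p' ∉ closure I⁻(K)`, and `B = I⁻(p') ∩ S₂` lies in the compact set
`C = ψ(J⁻(p⁺) ∩ S₁) ⊆ S₀`. If `p' ∈ closure I⁺(K)`, points `q_j → p'` with `k_j ≪ q_j`,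
`k_j ∈ K`, have `k_j` in the compact `J⁻(p'⁺) ∩ J⁺(S₂)` (`p' ≪ p'⁺`), so `k_j → k₀ ∈ K` along a
subsequence (`K` is closed), `k₀ ≤ p'` (`hrel₂`), `k₀ ≠ p'`, and `k₀ ≪ p'` is excluded
(`k₀ ∈ B ⊆ C ⊆ S₀`). Along the causal curve `η` from `k₀` to `p'` let `c` be the last parameter on
`S₂`; beyond `c`, `η` runs in `I⁺(S₂)`, so points `w_i ∈ S₂` with `w_i ≪ η(s_i)`, `s_i ↓ c`, lie in
`B ⊆ C`, accumulate at `w₀ ∈ C ⊆ S₀` with `w₀ ≤ η c` (`hrel₂`); acausality gives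
`w₀ = η c = k₀`, against `k₀ ∉ S₀`. The past case is the future case for the reversed time
orientations (`not_mem_closure_badSet_of_corresponding_past`).

Everything is proved; no definitions, no named facts.

## References

* J. Sbierski, Ann. Henri Poincaré 17 (2016) 301–329 = arXiv:1309.7591v3, §3.2, Def. 11,
  Prop. 13, Thm. 12 (arXiv numbering). [Sbierski2016AHP]
* S. W. Hawking, G. F. R. Ellis, *The large scale structure of space-time*, CUP 1973, §6.5,
  §6.6 Prop. 6.6.6, §7.6 pp. 249–251. [HawkingEllis1973CUP]
* B. O'Neill, *Semi-Riemannian geometry with applications to relativity*, Academic Press 1983,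
  Ch. 14, Cor. 14.1, Lemma 14.22, Lemma 14.29, p. 425. [ONeillSemiRiemannian1983]
-/

noncomputable section

open Set Filter Function TopologicalSpace Topology
open scoped Manifold ContDiff Topology

namespace Literature.Geometry.Lorentzian

namespace LorentzianMetric

section Core

variable {E₁ : Type*} [NormedAddCommGroup E₁] [NormedSpace ℝ E₁] {H₁ : Type*} [TopologicalSpace H₁]
  {I₁ : ModelWithCorners ℝ E₁ H₁} {n₁ : ℕ∞ω} {M₁ : Type*} [TopologicalSpace M₁] [ChartedSpace H₁ M₁]
  [IsManifold I₁ ∞ M₁] [T2Space M₁] [SecondCountableTopology M₁] [BoundarylessManifold I₁ M₁]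
  [FiniteDimensional ℝ E₁] {g₁ : LorentzianMetric I₁ n₁ M₁} {τ₁ : TimeOrientation g₁}
  {E₂ : Type*} [NormedAddCommGroup E₂] [NormedSpace ℝ E₂] {H₂ : Type*} [TopologicalSpace H₂]
  {I₂ : ModelWithCorners ℝ E₂ H₂} {n₂ : ℕ∞ω} {M₂ : Type*} [TopologicalSpace M₂] [ChartedSpace H₂ M₂]
  [IsManifold I₂ ∞ M₂] [T2Space M₂] [SecondCountableTopology M₂] [BoundarylessManifold I₂ M₂]
  [FiniteDimensional ℝ E₂] {g₂ : LorentzianMetric I₂ n₂ M₂} {τ₂ : TimeOrientation g₂}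

/-- **Future case: `p' ∉ closure (I⁺(S₂ ∖ S₀))`** for a corresponding pair `(p, p')` with
`p ∈ ∂U ∩ I⁺(S₁)` (see the module docstring for the proof). Hypotheses as in
`CorrespondingBoundaryShadow`, plus `hK₂` (compactness of `J⁻(x) ∩ J⁺(S₂)`), the acausality
`hac₂` of `S₂` and the closedness of `S₂ ∖ S₀`. [cite: Sbierski2016AHP, §3.2, Prop. 13 and Thm. 12 (arXiv numbering); HawkingEllis1973CUP, §6.5 and §7.6] -/
theorem not_mem_closure_chronologicalFuture_diff_of_corresponding (hn₁ : 2 ≤ n₁) (hn₂ : 2 ≤ n₂)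
    (hres₁ : PseudoRiemannianMetric.contMDiff_restrict (I := I₁) (n := n₁) (M := M₁))
    (hτ₁ : τ₁.contMDiff_restrict)
    (hres₂ : PseudoRiemannianMetric.contMDiff_restrict (I := I₂) (n := n₂) (M := M₂))
    (hτ₂ : τ₂.contMDiff_restrict)
    {S₁ : Set M₁} (hS₁ : g₁.IsCauchyHypersurface τ₁ S₁) {U : Opens M₁} (hS₁U : S₁ ⊆ U)
    (hU : (g₁.restrict hres₁ U).IsCauchyHypersurface (τ₁.restrict hres₁ hτ₁ U) (Subtype.val ⁻¹' S₁))
    {S₂ S₀ : Set M₂} (hS₂ : g₂.IsCauchyHypersurface τ₂ S₂) (hS₀S : S₀ ⊆ S₂)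
    (hKcl : IsClosed (S₂ \ S₀)) {W : Opens M₂}
    (hW : (g₂.restrict hres₂ W).IsCauchyHypersurface (τ₂.restrict hres₂ hτ₂ W) (Subtype.val ⁻¹' S₂))
    (hWS : (W : Set M₂) ∩ S₂ ⊆ S₀) {ψ : M₁ → M₂} (hψW : MapsTo ψ U W) (hψc : ContinuousOn ψ U)
    (hψS : ψ '' S₁ = S₀)
    (hpush : ∀ ⦃γ : ℝ → M₁⦄ ⦃a b : ℝ⦄, a < b → g₁.IsFutureTimelikeCurveOn τ₁ γ (Icc a b) →
      (∀ t ∈ Icc a b, γ t ∈ U) → ψ (γ b) ∈ g₂.chronologicalFuture τ₂ {ψ (γ a)})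
    (hpull : ∀ ⦃γ : ℝ → M₂⦄ ⦃a b : ℝ⦄, a < b → g₂.IsFutureTimelikeCurveOn τ₂ γ (Icc a b) →
      (∀ t ∈ Icc a b, γ t ∈ W) → ∀ ⦃x y : M₁⦄, x ∈ U → y ∈ U → γ a = ψ x → γ b = ψ y →
      y ∈ g₁.chronologicalFuture τ₁ {x})
    (hK₁ : ∀ x : M₁, IsCompact (g₁.causalPast τ₁ {x} ∩ g₁.causalFuture τ₁ S₁))
    (hK₂ : ∀ x : M₂, IsCompact (g₂.causalPast τ₂ {x} ∩ g₂.causalFuture τ₂ S₂))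
    (hrel₂ : ∀ {xs ys : ℕ → M₂} {x y : M₂}, Tendsto xs atTop (𝓝 x) → Tendsto ys atTop (𝓝 y) →
      (∀ j, ys j ∈ g₂.causalFuture τ₂ {xs j}) → y ∈ g₂.causalFuture τ₂ {x})
    (hac₂ : ∀ x ∈ S₂, ∀ y ∈ S₂, y ∈ g₂.causalFuture τ₂ {x} → y = x)
    {p : M₁} (hp : p ∈ frontier (U : Set M₁)) (hpI : p ∈ g₁.chronologicalFuture τ₁ S₁) {p' : M₂}
    (hcorr : ∀ V ∈ 𝓝 p, ∀ V' ∈ 𝓝 p', ∃ y ∈ (U : Set M₁), y ∈ V ∧ ψ y ∈ V') :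
    p' ∉ closure (g₂.chronologicalFuture τ₂ (S₂ \ S₀)) := by
  intro hcl
  haveI : LocallyCompactSpace M₂ := Manifold.locallyCompact_of_finiteDimensional (M := M₂) I₂
  haveI : TopologicalSpace.MetrizableSpace M₂ := Manifold.metrizableSpace I₂ M₂
  letI : MetricSpace M₂ := TopologicalSpace.metrizableSpaceMetric M₂
  have hn2' : (1 : ℕ∞ω) ≤ n₂ := le_trans one_le_two hn₂
  have hS₂cl : IsClosed S₂ := IsCauchyHypersurface.isClosed_holds hn₂ hS₂
  -- points below `p`; the basic facts about `p'`
  obtain ⟨r, r₁, hrU, hr₁U, hrI, hrr₁, hpr₁⟩ := exists_mem_opens_ll_ll hn₁ hres₁ hτ₁ hS₁ hU hp hpI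
  obtain ⟨-, -, -, hp'S⟩ := mem_chronologicalFuture_glue_of_corresponding hn₁ hn₂ hres₁ hτ₁ hS₁
    hS₁U hU hS₂ hS₀S hψS hpush hrel₂ hcorr hrU hr₁U hrI hrr₁ hpr₁
  -- a point above `p` and the compact set `C ⊇ I⁻(p') ∩ S₂`
  obtain ⟨pf, hpf⟩ := exists_mem_chronologicalFuture_singleton (g := g₁) (τ := τ₁) hn₁ p
  set C : Set M₂ := ψ '' (g₁.causalPast τ₁ {pf} ∩ S₁) with hC
  have hCc : IsCompact C := isCompact_image_causalPast_inter hn₁ hS₁ hS₁U hK₁ hψc pf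
  have hCS₀ : C ⊆ S₀ := by
    rintro _ ⟨s, hs, rfl⟩
    rw [← hψS]
    exact mem_image_of_mem ψ hs.2
  have hBC : g₂.chronologicalPast τ₂ {p'} ∩ S₂ ⊆ C :=
    chronologicalPast_inter_subset_image_of_corresponding hn₂ hres₂ hτ₂ hS₁U hS₂ hW hWS hψW hψS
      hpull hpf hcorr
  -- a point above `p'` and the bad sequence `k_j ≪ q_j → p'`
  obtain ⟨pf', hpf'⟩ := exists_mem_chronologicalFuture_singleton (g := g₂) (τ := τ₂) hn₂ p'
  have hcl' : p' ∈ closure (g₂.chronologicalPast τ₂ {pf'} ∩ g₂.chronologicalFuture τ₂ (S₂ \ S₀)) :=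
    (isOpen_chronologicalPast_of_boundaryless g₂ τ₂ {pf'}).inter_closure
      ⟨mem_chronologicalPast_of_mem_chronologicalFuture hpf', hcl⟩
  obtain ⟨q, hq, hqlim⟩ := mem_closure_iff_seq_limit.1 hcl'
  have hk : ∀ j, ∃ k, k ∈ S₂ \ S₀ ∧ q j ∈ g₂.chronologicalFuture τ₂ {k} := fun j ↦ by
    have h := (hq j).2
    rw [chronologicalFuture_eq_biUnion] at h
    simpa only [mem_iUnion, exists_prop] using h
  choose k hkK hqk using hk
  have hkmem : ∀ j, k j ∈ g₂.causalPast τ₂ {pf'} ∩ g₂.causalFuture τ₂ S₂ := fun j ↦ by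
    refine ⟨?_, subset_causalFuture g₂ τ₂ S₂ (hkK j).1⟩
    have h1 : pf' ∈ g₂.chronologicalFuture τ₂ {q j} :=
      mem_chronologicalFuture_of_mem_chronologicalPast (hq j).1
    have h2 : pf' ∈ g₂.chronologicalFuture τ₂ {k j} := mem_chronologicalFuture_trans (hqk j) h1
    exact chronologicalFuture_subset_causalFuture g₂ τ₂.reverse {pf'}
      (mem_chronologicalPast_of_mem_chronologicalFuture h2)
  obtain ⟨k₀, -, φ, hφ, hklim⟩ := (hK₂ pf').tendsto_subseq hkmem
  have hk₀K : k₀ ∈ S₂ \ S₀ := hKcl.mem_of_tendsto hklim (Eventually.of_forall fun j ↦ hkK (φ j))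
  -- `k₀ ≤ p'`, `k₀ ≠ p'`, and not `k₀ ≪ p'`
  have hk₀p' : p' ∈ g₂.causalFuture τ₂ {k₀} :=
    hrel₂ hklim (hqlim.comp hφ.tendsto_atTop) fun j ↦
      chronologicalFuture_subset_causalFuture g₂ τ₂ _ (hqk (φ j))
  have hk₀ne : p' ≠ k₀ := fun h ↦ hp'S (h ▸ hk₀K.1)
  -- a causal curve `η` from `k₀` to `p'`
  obtain ⟨x₀, hx₀, η, a, b, hab, hη, hηa, hηb⟩ : ∃ x ∈ ({k₀} : Set M₂), ∃ (η : ℝ → M₂) (a b : ℝ),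
      a < b ∧ g₂.IsFutureCausalCurveOn τ₂ η (Icc a b) ∧ η a = x ∧ η b = p' := by
    rcases hk₀p' with h | h
    · exact absurd (mem_singleton_iff.1 h) hk₀ne
    · exact h
  rw [mem_singleton_iff] at hx₀
  rw [hx₀] at hηa
  have hcont : ∀ t ∈ Icc a b, ContinuousAt η t := fun t ht ↦ (hη t ht).1.continuousAt
  -- the last parameter `c` of `η` on `S₂`
  set A : Set ℝ := Icc a b ∩ η ⁻¹' S₂ with hA_def
  have hAcl : IsClosed A :=
    (continuousOn_of_forall_continuousAt hcont).preimage_isClosed_of_isClosed isClosed_Icc hS₂cl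
  have haA : a ∈ A := ⟨left_mem_Icc.2 hab.le, by show η a ∈ S₂; rw [hηa]; exact hk₀K.1⟩
  have hAbdd : BddAbove A := ⟨b, fun t ht ↦ ht.1.2⟩
  set c := sSup A with hc_def
  have hcA : c ∈ A := hAcl.csSup_mem ⟨a, haA⟩ hAbdd
  have hac : a ≤ c := hcA.1.1
  have hηcS : η c ∈ S₂ := hcA.2
  have hcb : c < b := lt_of_le_of_ne hcA.1.2 fun h ↦ hp'S (by rw [← hηb, ← h]; exact hηcS)
  have hafter : ∀ t ∈ Ioc c b, η t ∉ S₂ := fun t ht h ↦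
    (not_le.2 ht.1) (le_csSup hAbdd ⟨⟨hac.trans ht.1.le, ht.2⟩, h⟩)
  -- beyond `c` the curve runs in `I⁺(S₂)`: points `w ∈ S₂` below `η t`, which lie in `I⁻(p')`
  have hw : ∀ t ∈ Ioc c b, ∃ w, w ∈ S₂ ∧ η t ∈ g₂.chronologicalFuture τ₂ {w} := fun t ht ↦ by
    have h1 : η t ∈ g₂.causalFuture τ₂ S₂ :=
      causalFuture_mono (singleton_subset_iff.2 hηcS) (mem_causalFuture_of_curve hη hac ht.1.le ht.2)
    have h2 : η t ∈ g₂.chronologicalFuture τ₂ S₂ :=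
      hS₂.mem_chronologicalFuture_of_mem_causalFuture_diff hn₂ h1 (hafter t ht)
    rw [chronologicalFuture_eq_biUnion] at h2
    simpa only [mem_iUnion, exists_prop] using h2
  -- the parameters `s i ↓ c`
  set s : ℕ → ℝ := fun i ↦ c + (b - c) / 2 * (1 / ((i : ℝ) + 1)) with hs_def
  have hsmem : ∀ i, s i ∈ Ioc c b := fun i ↦ by
    have hi : (0 : ℝ) < (i : ℝ) + 1 := by positivity
    have h1 : 0 < (b - c) / 2 * (1 / ((i : ℝ) + 1)) := by
      have : 0 < b - c := by linarith
      positivity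
    have h2 : (b - c) / 2 * (1 / ((i : ℝ) + 1)) ≤ (b - c) / 2 := by
      have h3 : 1 / ((i : ℝ) + 1) ≤ 1 := by
        rw [div_le_one hi]
        have := Nat.cast_nonneg (α := ℝ) i
        linarith
      have h4 : 0 ≤ (b - c) / 2 := by linarith
      nlinarith
    refine ⟨by simp only [hs_def]; linarith, by simp only [hs_def]; linarith⟩
  have hslim : Tendsto s atTop (𝓝 c) := by
    have h := ((tendsto_one_div_add_atTop_nhds_zero_nat (𝕜 := ℝ)).const_mul ((b - c) / 2)).const_add c
    rw [mul_zero, add_zero] at h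
    exact h
  choose w hwS hηw using fun i ↦ hw (s i) (hsmem i)
  have hwC : ∀ i, w i ∈ C := fun i ↦ by
    refine hBC ⟨?_, hwS i⟩
    have h1 : p' ∈ g₂.causalFuture τ₂ {η (s i)} := by
      rw [← hηb]
      exact mem_causalFuture_of_curve hη (hac.trans (hsmem i).1.le) (hsmem i).2 le_rfl
    exact mem_chronologicalPast_of_mem_chronologicalFuture
      (mem_chronologicalFuture_of_mem_chronologicalFuture_of_mem_causalFuture hn2' (hηw i) h1)
  obtain ⟨w₀, hw₀C, φ', hφ', hwlim⟩ := hCc.tendsto_subseq hwC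
  -- `w₀ ≤ η c`, hence `w₀ = η c` by acausality
  have hηlim : Tendsto (fun i ↦ η (s (φ' i))) atTop (𝓝 (η c)) :=
    ((hcont c hcA.1).tendsto.comp hslim).comp hφ'.tendsto_atTop
  have hw₀c : η c ∈ g₂.causalFuture τ₂ {w₀} :=
    hrel₂ hwlim hηlim fun i ↦ chronologicalFuture_subset_causalFuture g₂ τ₂ _ (hηw (φ' i))
  have hw₀S : w₀ ∈ S₂ := hS₀S (hCS₀ hw₀C)
  have heq1 : η c = w₀ := hac₂ w₀ hw₀S (η c) hηcS hw₀c
  -- `k₀ ≤ η c`, hence `η c = k₀` by acausality: but `k₀ ∉ S₀ ∋ w₀`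
  have hk₀c : η c ∈ g₂.causalFuture τ₂ {k₀} := by
    rw [← hηa]
    exact mem_causalFuture_of_curve hη le_rfl hac hcA.1.2
  have heq2 : η c = k₀ := hac₂ k₀ hk₀K.1 (η c) hηcS hk₀c
  have hk₀S₀ : k₀ ∈ S₀ := by
    rw [← heq2, heq1]
    exact hCS₀ hw₀C
  exact hk₀K.2 hk₀S₀

/-- **Future case of the theorem: `p' ∉ closure (I⁺(K) ∪ I⁻(K) ∪ K)`, `K = S₂ ∖ S₀`**, for a
corresponding pair `(p, p')` with `p ∈ ∂U ∩ I⁺(S₁)`: the three pieces are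
`not_mem_closure_chronologicalFuture_diff_of_corresponding`,
`not_mem_closure_chronologicalPast_of_corresponding` and `p' ∉ S₂`
(`mem_chronologicalFuture_glue_of_corresponding`). [cite: Sbierski2016AHP, §3.2, Prop. 13 and Thm. 12 (arXiv numbering); HawkingEllis1973CUP, §6.5 and §7.6] -/
theorem not_mem_closure_badSet_of_corresponding_future (hn₁ : 2 ≤ n₁) (hn₂ : 2 ≤ n₂)
    (hres₁ : PseudoRiemannianMetric.contMDiff_restrict (I := I₁) (n := n₁) (M := M₁))
    (hτ₁ : τ₁.contMDiff_restrict)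
    (hres₂ : PseudoRiemannianMetric.contMDiff_restrict (I := I₂) (n := n₂) (M := M₂))
    (hτ₂ : τ₂.contMDiff_restrict)
    {S₁ : Set M₁} (hS₁ : g₁.IsCauchyHypersurface τ₁ S₁) {U : Opens M₁} (hS₁U : S₁ ⊆ U)
    (hU : (g₁.restrict hres₁ U).IsCauchyHypersurface (τ₁.restrict hres₁ hτ₁ U) (Subtype.val ⁻¹' S₁))
    {S₂ S₀ : Set M₂} (hS₂ : g₂.IsCauchyHypersurface τ₂ S₂) (hS₀S : S₀ ⊆ S₂)
    (hKcl : IsClosed (S₂ \ S₀)) {W : Opens M₂}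
    (hW : (g₂.restrict hres₂ W).IsCauchyHypersurface (τ₂.restrict hres₂ hτ₂ W) (Subtype.val ⁻¹' S₂))
    (hWS : (W : Set M₂) ∩ S₂ ⊆ S₀) {ψ : M₁ → M₂} (hψW : MapsTo ψ U W) (hψc : ContinuousOn ψ U)
    (hψS : ψ '' S₁ = S₀)
    (hpush : ∀ ⦃γ : ℝ → M₁⦄ ⦃a b : ℝ⦄, a < b → g₁.IsFutureTimelikeCurveOn τ₁ γ (Icc a b) →
      (∀ t ∈ Icc a b, γ t ∈ U) → ψ (γ b) ∈ g₂.chronologicalFuture τ₂ {ψ (γ a)})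
    (hpull : ∀ ⦃γ : ℝ → M₂⦄ ⦃a b : ℝ⦄, a < b → g₂.IsFutureTimelikeCurveOn τ₂ γ (Icc a b) →
      (∀ t ∈ Icc a b, γ t ∈ W) → ∀ ⦃x y : M₁⦄, x ∈ U → y ∈ U → γ a = ψ x → γ b = ψ y →
      y ∈ g₁.chronologicalFuture τ₁ {x})
    (hK₁ : ∀ x : M₁, IsCompact (g₁.causalPast τ₁ {x} ∩ g₁.causalFuture τ₁ S₁))
    (hK₂ : ∀ x : M₂, IsCompact (g₂.causalPast τ₂ {x} ∩ g₂.causalFuture τ₂ S₂))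
    (hrel₂ : ∀ {xs ys : ℕ → M₂} {x y : M₂}, Tendsto xs atTop (𝓝 x) → Tendsto ys atTop (𝓝 y) →
      (∀ j, ys j ∈ g₂.causalFuture τ₂ {xs j}) → y ∈ g₂.causalFuture τ₂ {x})
    (hac₂ : ∀ x ∈ S₂, ∀ y ∈ S₂, y ∈ g₂.causalFuture τ₂ {x} → y = x)
    {p : M₁} (hp : p ∈ frontier (U : Set M₁)) (hpI : p ∈ g₁.chronologicalFuture τ₁ S₁) {p' : M₂}
    (hcorr : ∀ V ∈ 𝓝 p, ∀ V' ∈ 𝓝 p', ∃ y ∈ (U : Set M₁), y ∈ V ∧ ψ y ∈ V') :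
    p' ∉ closure (g₂.chronologicalFuture τ₂ (S₂ \ S₀) ∪ g₂.chronologicalPast τ₂ (S₂ \ S₀) ∪
      (S₂ \ S₀)) := by
  obtain ⟨r, r₁, hrU, hr₁U, hrI, hrr₁, hpr₁⟩ := exists_mem_opens_ll_ll hn₁ hres₁ hτ₁ hS₁ hU hp hpI
  obtain ⟨hp'r, hψrI, -, hp'S⟩ := mem_chronologicalFuture_glue_of_corresponding hn₁ hn₂ hres₁ hτ₁
    hS₁ hS₁U hU hS₂ hS₀S hψS hpush hrel₂ hcorr hrU hr₁U hrI hrr₁ hpr₁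
  rw [closure_union, closure_union, hKcl.closure_eq]
  rintro ((h | h) | h)
  · exact not_mem_closure_chronologicalFuture_diff_of_corresponding hn₁ hn₂ hres₁ hτ₁ hres₂ hτ₂ hS₁
      hS₁U hU hS₂ hS₀S hKcl hW hWS hψW hψc hψS hpush hpull hK₁ hK₂ hrel₂ hac₂ hp hpI hcorr h
  · exact not_mem_closure_chronologicalPast_of_corresponding hn₂ hS₂ hp'r hψrI (fun x hx ↦ hx.1) h
  · exact hp'S h.1

/-- **Past case** (`p ∈ ∂U ∩ I⁻(S₁)`): the future case for the reversed time orientations `-τ₁`,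
`-τ₂` — Cauchy hypersurfaces, the transport hypotheses, closedness of `≤` and acausality are
self-dual, `I±` and `J±` are exchanged (so the compactness hypotheses enter in the dual form
`hK₁'`, `hK₂'`). O'Neill 1983, Ch. 14, p. 402 (time duality). [cite: Sbierski2016AHP, §3.2, Prop. 13 and Thm. 12 (arXiv numbering); ONeillSemiRiemannian1983, Ch. 14, p. 402] -/
theorem not_mem_closure_badSet_of_corresponding_past (hn₁ : 2 ≤ n₁) (hn₂ : 2 ≤ n₂)
    (hres₁ : PseudoRiemannianMetric.contMDiff_restrict (I := I₁) (n := n₁) (M := M₁))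
    (hτ₁ : τ₁.contMDiff_restrict)
    (hres₂ : PseudoRiemannianMetric.contMDiff_restrict (I := I₂) (n := n₂) (M := M₂))
    (hτ₂ : τ₂.contMDiff_restrict)
    {S₁ : Set M₁} (hS₁ : g₁.IsCauchyHypersurface τ₁ S₁) {U : Opens M₁} (hS₁U : S₁ ⊆ U)
    (hU : (g₁.restrict hres₁ U).IsCauchyHypersurface (τ₁.restrict hres₁ hτ₁ U) (Subtype.val ⁻¹' S₁))
    {S₂ S₀ : Set M₂} (hS₂ : g₂.IsCauchyHypersurface τ₂ S₂) (hS₀S : S₀ ⊆ S₂)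
    (hKcl : IsClosed (S₂ \ S₀)) {W : Opens M₂}
    (hW : (g₂.restrict hres₂ W).IsCauchyHypersurface (τ₂.restrict hres₂ hτ₂ W) (Subtype.val ⁻¹' S₂))
    (hWS : (W : Set M₂) ∩ S₂ ⊆ S₀) {ψ : M₁ → M₂} (hψW : MapsTo ψ U W) (hψc : ContinuousOn ψ U)
    (hψS : ψ '' S₁ = S₀)
    (hpush : ∀ ⦃γ : ℝ → M₁⦄ ⦃a b : ℝ⦄, a < b → g₁.IsFutureTimelikeCurveOn τ₁ γ (Icc a b) →
      (∀ t ∈ Icc a b, γ t ∈ U) → ψ (γ b) ∈ g₂.chronologicalFuture τ₂ {ψ (γ a)})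
    (hpull : ∀ ⦃γ : ℝ → M₂⦄ ⦃a b : ℝ⦄, a < b → g₂.IsFutureTimelikeCurveOn τ₂ γ (Icc a b) →
      (∀ t ∈ Icc a b, γ t ∈ W) → ∀ ⦃x y : M₁⦄, x ∈ U → y ∈ U → γ a = ψ x → γ b = ψ y →
      y ∈ g₁.chronologicalFuture τ₁ {x})
    (hK₁' : ∀ x : M₁, IsCompact (g₁.causalFuture τ₁ {x} ∩ g₁.causalPast τ₁ S₁))
    (hK₂' : ∀ x : M₂, IsCompact (g₂.causalFuture τ₂ {x} ∩ g₂.causalPast τ₂ S₂))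
    (hrel₂ : ∀ {xs ys : ℕ → M₂} {x y : M₂}, Tendsto xs atTop (𝓝 x) → Tendsto ys atTop (𝓝 y) →
      (∀ j, ys j ∈ g₂.causalFuture τ₂ {xs j}) → y ∈ g₂.causalFuture τ₂ {x})
    (hac₂ : ∀ x ∈ S₂, ∀ y ∈ S₂, y ∈ g₂.causalFuture τ₂ {x} → y = x)
    {p : M₁} (hp : p ∈ frontier (U : Set M₁)) (hpI : p ∈ g₁.chronologicalPast τ₁ S₁) {p' : M₂}
    (hcorr : ∀ V ∈ 𝓝 p, ∀ V' ∈ 𝓝 p', ∃ y ∈ (U : Set M₁), y ∈ V ∧ ψ y ∈ V') :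
    p' ∉ closure (g₂.chronologicalFuture τ₂ (S₂ \ S₀) ∪ g₂.chronologicalPast τ₂ (S₂ \ S₀) ∪
      (S₂ \ S₀)) := by
  have hτ₁' : τ₁.reverse.contMDiff_restrict := τ₁.contMDiff_restrict_reverse hτ₁
  have hτ₂' : τ₂.reverse.contMDiff_restrict := τ₂.contMDiff_restrict_reverse hτ₂
  have hU' : (g₁.restrict hres₁ U).IsCauchyHypersurface (τ₁.reverse.restrict hres₁ hτ₁' U)
      (Subtype.val ⁻¹' S₁) := by
    rw [← TimeOrientation.restrict_reverse]
    exact hU.reverse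
  have hW' : (g₂.restrict hres₂ W).IsCauchyHypersurface (τ₂.reverse.restrict hres₂ hτ₂' W)
      (Subtype.val ⁻¹' S₂) := by
    rw [← TimeOrientation.restrict_reverse]
    exact hW.reverse
  -- the transport hypotheses for the reversed orientations (reverse the parameter)
  have hpush' : ∀ ⦃γ : ℝ → M₁⦄ ⦃a b : ℝ⦄, a < b → g₁.IsFutureTimelikeCurveOn τ₁.reverse γ (Icc a b) →
      (∀ t ∈ Icc a b, γ t ∈ U) →
      ψ (γ b) ∈ g₂.chronologicalFuture τ₂.reverse {ψ (γ a)} := by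
    intro γ a b hab hγ hγU
    have hγ' : g₁.IsFutureTimelikeCurveOn τ₁ (fun t ↦ γ (a + b - t)) (Icc a b) :=
      isFutureTimelikeCurveOn_reverse_reverse_iff.1 hγ.reverseParam
    have hγU' : ∀ t ∈ Icc a b, γ (a + b - t) ∈ U := fun t ht ↦
      hγU (a + b - t) ⟨by linarith [ht.2], by linarith [ht.1]⟩
    have h := hpush hab hγ' hγU'
    have h' : ψ (γ (a + b - b)) ∈ g₂.chronologicalFuture τ₂ {ψ (γ (a + b - a))} := h
    rw [add_sub_cancel_right, add_sub_cancel_left] at h'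
    exact mem_chronologicalPast_of_mem_chronologicalFuture h'
  have hpull' : ∀ ⦃γ : ℝ → M₂⦄ ⦃a b : ℝ⦄, a < b → g₂.IsFutureTimelikeCurveOn τ₂.reverse γ (Icc a b) →
      (∀ t ∈ Icc a b, γ t ∈ W) → ∀ ⦃x y : M₁⦄, x ∈ U → y ∈ U → γ a = ψ x → γ b = ψ y →
      y ∈ g₁.chronologicalFuture τ₁.reverse {x} := by
    intro γ a b hab hγ hγW x y hx hy hγa hγb
    have hγ' : g₂.IsFutureTimelikeCurveOn τ₂ (fun t ↦ γ (a + b - t)) (Icc a b) :=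
      isFutureTimelikeCurveOn_reverse_reverse_iff.1 hγ.reverseParam
    have hγW' : ∀ t ∈ Icc a b, γ (a + b - t) ∈ W := fun t ht ↦
      hγW (a + b - t) ⟨by linarith [ht.2], by linarith [ht.1]⟩
    have h := hpull hab hγ' hγW' hy hx (by show γ (a + b - a) = ψ y; rw [add_sub_cancel_left]; exact hγb)
      (by show γ (a + b - b) = ψ x; rw [add_sub_cancel_right]; exact hγa)
    exact mem_chronologicalPast_of_mem_chronologicalFuture h
  have hK₁'' : ∀ x : M₁, IsCompact (g₁.causalPast τ₁.reverse {x} ∩ g₁.causalFuture τ₁.reverse S₁) :=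
    fun x ↦ by rw [causalPast_reverse]; exact hK₁' x
  have hK₂'' : ∀ x : M₂, IsCompact (g₂.causalPast τ₂.reverse {x} ∩ g₂.causalFuture τ₂.reverse S₂) :=
    fun x ↦ by rw [causalPast_reverse]; exact hK₂' x
  have hrel₂' : ∀ {xs ys : ℕ → M₂} {x y : M₂}, Tendsto xs atTop (𝓝 x) → Tendsto ys atTop (𝓝 y) →
      (∀ j, ys j ∈ g₂.causalFuture τ₂.reverse {xs j}) → y ∈ g₂.causalFuture τ₂.reverse {x} := by
    intro xs ys x y hx hy h
    show y ∈ g₂.causalPast τ₂ {x}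
    exact mem_causalPast_singleton_iff.2 (hrel₂ hy hx fun j ↦ mem_causalPast_singleton_iff.1 (h j))
  have hac₂' : ∀ x ∈ S₂, ∀ y ∈ S₂, y ∈ g₂.causalFuture τ₂.reverse {x} → y = x :=
    fun x hx y hy h ↦ (hac₂ y hy x hx (mem_causalPast_singleton_iff.1 h)).symm
  have h := not_mem_closure_badSet_of_corresponding_future (τ₁ := τ₁.reverse) (τ₂ := τ₂.reverse)
    hn₁ hn₂ hres₁ hτ₁' hres₂ hτ₂' hS₁.reverse hS₁U hU' hS₂.reverse hS₀S hKcl hW' hWS hψW hψc hψS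
    hpush' hpull' hK₁'' hK₂'' hrel₂' hac₂' hp hpI hcorr
  rw [chronologicalPast_reverse] at h
  have heq : g₂.chronologicalFuture τ₂.reverse (S₂ \ S₀) = g₂.chronologicalPast τ₂ (S₂ \ S₀) := rfl
  rw [heq, union_comm (g₂.chronologicalPast τ₂ (S₂ \ S₀))] at h
  exact h

/-- **Theorem: the image point of a corresponding boundary pair lies in the Cauchy piece domain of
the sub-datum** — for any `p ∈ ∂U` (which lies in `I⁺(S₁)` or in `I⁻(S₁)`, as `S₁ ⊆ U` and
`M₁ = I⁻(S₁) ⊔ S₁ ⊔ I⁺(S₁)`), `p' ∉ closure (I⁺(K) ∪ I⁻(K) ∪ K)`, `K = S₂ ∖ S₀`. The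
global-hyperbolicity inputs are displayed in both time directions (`hK₁`, `hK₁'`, `hK₂`, `hK₂'`,
`hrel₂`) together with the acausality `hac₂` of `S₂`. [cite: Sbierski2016AHP, §3.2, Prop. 13 and Thm. 12 (arXiv numbering); HawkingEllis1973CUP, §6.5 and §7.6] -/
theorem not_mem_closure_badSet_of_corresponding (hn₁ : 2 ≤ n₁) (hn₂ : 2 ≤ n₂)
    (hres₁ : PseudoRiemannianMetric.contMDiff_restrict (I := I₁) (n := n₁) (M := M₁))
    (hτ₁ : τ₁.contMDiff_restrict)
    (hres₂ : PseudoRiemannianMetric.contMDiff_restrict (I := I₂) (n := n₂) (M := M₂))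
    (hτ₂ : τ₂.contMDiff_restrict)
    {S₁ : Set M₁} (hS₁ : g₁.IsCauchyHypersurface τ₁ S₁) {U : Opens M₁} (hS₁U : S₁ ⊆ U)
    (hU : (g₁.restrict hres₁ U).IsCauchyHypersurface (τ₁.restrict hres₁ hτ₁ U) (Subtype.val ⁻¹' S₁))
    {S₂ S₀ : Set M₂} (hS₂ : g₂.IsCauchyHypersurface τ₂ S₂) (hS₀S : S₀ ⊆ S₂)
    (hKcl : IsClosed (S₂ \ S₀)) {W : Opens M₂}
    (hW : (g₂.restrict hres₂ W).IsCauchyHypersurface (τ₂.restrict hres₂ hτ₂ W) (Subtype.val ⁻¹' S₂))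
    (hWS : (W : Set M₂) ∩ S₂ ⊆ S₀) {ψ : M₁ → M₂} (hψW : MapsTo ψ U W) (hψc : ContinuousOn ψ U)
    (hψS : ψ '' S₁ = S₀)
    (hpush : ∀ ⦃γ : ℝ → M₁⦄ ⦃a b : ℝ⦄, a < b → g₁.IsFutureTimelikeCurveOn τ₁ γ (Icc a b) →
      (∀ t ∈ Icc a b, γ t ∈ U) → ψ (γ b) ∈ g₂.chronologicalFuture τ₂ {ψ (γ a)})
    (hpull : ∀ ⦃γ : ℝ → M₂⦄ ⦃a b : ℝ⦄, a < b → g₂.IsFutureTimelikeCurveOn τ₂ γ (Icc a b) →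
      (∀ t ∈ Icc a b, γ t ∈ W) → ∀ ⦃x y : M₁⦄, x ∈ U → y ∈ U → γ a = ψ x → γ b = ψ y →
      y ∈ g₁.chronologicalFuture τ₁ {x})
    (hK₁ : ∀ x : M₁, IsCompact (g₁.causalPast τ₁ {x} ∩ g₁.causalFuture τ₁ S₁))
    (hK₁' : ∀ x : M₁, IsCompact (g₁.causalFuture τ₁ {x} ∩ g₁.causalPast τ₁ S₁))
    (hK₂ : ∀ x : M₂, IsCompact (g₂.causalPast τ₂ {x} ∩ g₂.causalFuture τ₂ S₂))
    (hK₂' : ∀ x : M₂, IsCompact (g₂.causalFuture τ₂ {x} ∩ g₂.causalPast τ₂ S₂))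
    (hrel₂ : ∀ {xs ys : ℕ → M₂} {x y : M₂}, Tendsto xs atTop (𝓝 x) → Tendsto ys atTop (𝓝 y) →
      (∀ j, ys j ∈ g₂.causalFuture τ₂ {xs j}) → y ∈ g₂.causalFuture τ₂ {x})
    (hac₂ : ∀ x ∈ S₂, ∀ y ∈ S₂, y ∈ g₂.causalFuture τ₂ {x} → y = x)
    {p : M₁} (hp : p ∈ frontier (U : Set M₁)) {p' : M₂}
    (hcorr : ∀ V ∈ 𝓝 p, ∀ V' ∈ 𝓝 p', ∃ y ∈ (U : Set M₁), y ∈ V ∧ ψ y ∈ V') :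
    p' ∉ closure (g₂.chronologicalFuture τ₂ (S₂ \ S₀) ∪ g₂.chronologicalPast τ₂ (S₂ \ S₀) ∪
      (S₂ \ S₀)) := by
  have hpU : p ∉ U := fun h ↦ (eq_empty_iff_forall_notMem.1 U.2.inter_frontier_eq) p ⟨h, hp⟩
  have hpS₁ : p ∉ S₁ := fun h ↦ hpU (hS₁U h)
  rcases hS₁.mem_chronologicalFuture_union_chronologicalPast hn₁ hpS₁ with hpI | hpI
  · exact not_mem_closure_badSet_of_corresponding_future hn₁ hn₂ hres₁ hτ₁ hres₂ hτ₂ hS₁ hS₁U hU hS₂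
      hS₀S hKcl hW hWS hψW hψc hψS hpush hpull hK₁ hK₂ hrel₂ hac₂ hp hpI hcorr
  · exact not_mem_closure_badSet_of_corresponding_past hn₁ hn₂ hres₁ hτ₁ hres₂ hτ₂ hS₁ hS₁U hU hS₂
      hS₀S hKcl hW hWS hψW hψc hψS hpush hpull hK₁' hK₂' hrel₂ hac₂ hp hpI hcorr

end Core

end LorentzianMetric

end Literature.Geometry.Lorentzian

end
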